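import Summits.HodgeConjecture.HodgeConjecture.Theorems.F0P3cStCharTSHCDescentSemisimpleSlice   -- (this seat) file C₂: `exists_slice_chart`; brings file C₁, file A, ★ FILE 2′, ★ D1, ★ (U)
import Mathlib.MeasureTheory.Measure.Haar.Unique
import HarnessLib

/-!
# F0 · P3c · line LH6 «StCharTS» — ROAD «HC-D», brick (D5ii) «SEMISIMPLE DESCENT AT TYPE (a,a,b)», file D (DESCENT PRINCIPLE): local integrability of a
# conjugation-invariant function on the `F`-Lie algebra `𝔲` NEAR A SKEW SEMISIMPLE `S₀` follows from its integrability on a small ball of the CENTRALISER slice `S₀ + 𝔠`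

Cell `pub/hodgecm-mathlib`, crux H413 = `stmt-HodgeConjecture-24833` (lane `--supports … --as helper`), route HCCMUnconditional; seat F0P3a-p05 (g23), brick (D4e)+(D5ii)
of F0P2-p01 (g23)'s road «HC-D» (census `F0/P2/p01/g23/CENSUS-HCD.v1.F0P2p01g23.md` §1 (ii); dealt 2026-09-02T16:11:14Z).
THEOREMS ONLY (no definition ∕ instance ∕ notation ∕ named fact ∕ `sorry`); imports (this seat) file C₂ + Mathlib (`Haar.Unique`).
HONEST LABEL: HC_CM is proved only modulo the 7 printed citations (2 remaining: hLiu418 = `stmt-HodgeConjecture-24832`, h413 = `stmt-HodgeConjecture-24833`)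
until rung 0 closes; count-neutral analysis for the named input (HC-D) «`|D_G|^{−1∕2} ∈ L¹_loc(G)`» [HarishChandra1970, Part VII §1 Thm. 15] of the (S-𝔇) organ; closes no organ.

THE MATHEMATICS (Harish-Chandra's descent to the centraliser of a semisimple element, Lie-algebra version [HarishChandra1970, Part VI Lemma 22, Part VII §1]).
Setting of file C₂ (`K` complete ultrametric nontrivially normed, proper, second countable, perfect, `char 0`; `σ` continuous, `J` unit determinant, `𝔲` the `F`-submodule of skew
matrices, `S₀ ∈ 𝔲` annihilated by a separable polynomial; `𝔪 = 𝔲 ⊓ range (ad S₀)`, `𝔠 = 𝔲 ⊓ ker (ad S₀)`; elementwise norms); `μ𝔲`, `μ𝔠` ANY additive Haar measures on `𝔲`, `𝔠`;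
`g : M_n(K) → ℝ≥0∞` measurable and CONJUGATION-INVARIANT in the weak sense `charpoly X = charpoly Y → g X = g Y` (the road's `g = |disc ∘ charpoly|^{−s}`).
**`exists_nhds_setLIntegral_lt_top_of_slice`** — if `∫⁻ Z in closedBall 0 ρ, g (S₀ + Z) ∂μ𝔠 < ∞` for some `ρ > 0`, then `∃ U ∈ 𝓝 S₀` (in `𝔲`) with `∫⁻ X in U, g X ∂μ𝔲 < ∞`.
PROOF.  Box filtration `Λ_j = closedBall 0 (2^{-(j+1)})` of `𝔪 × 𝔠` (★ D1 `exists_addSubgroup_coe_eq_closedBall`); `μ := μ𝔪 × μ𝔠` (Haar); ★ file C₂ `exists_slice_chart` gives `e : 𝔪 × 𝔠 ≃ₜ+ 𝔲`,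
`k₀`; take `k ≥ k₀` with `2^{-(k+1)} ≤ ρ`, `U := S₀ + e(Λ_k)` — a neighbourhood since `e` is a homeomorphism.  `μ.map e` is a Haar measure on `𝔲`, so `μ𝔲 = c • μ.map e`
(Mathlib `isAddLeftInvariant_eq_smul`); by left invariance and the change of variables along `e`, `∫⁻_{U} g ∂(μ.map e) = ∫⁻_{Λ_k} g(S₀ + e v) ∂μ = ∫⁻_{Λ_k} g(Ψ v) ∂μ` (file C₂)
`= ∫⁻_{Λ_k} g(S₀ + v₂) ∂μ` (conjugation invariance: file C₁ `charpoly_slice_eq`, `‖v₁‖ ≤ 2^{-(k+1)} < 1`) `= μ𝔪(ball) · ∫⁻_{ball} g(S₀ + Z) ∂μ𝔠 < ∞` (Tonelli on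
`Λ_k = ball × ball`, Mathlib `closedBall_prod_same`, `Measure.prod_restrict`, `lintegral_prod_mul`).  File E evaluates the `𝔠`-integral in normal form (★ file A §2) on D3b.

## References
* [HarishChandra1970] Harish-Chandra (notes by G. van Dijk), *Harmonic Analysis on Reductive p-adic Groups*, LNM 162 (1970), Part VI Lemma 22; Part VII §1 Thm. 15.
* [Rogawski1990] J. D. Rogawski, *Automorphic Representations of Unitary Groups in Three Variables*, Ann. of Math. Stud. 123 (1990), §8.2 Prop. 8.2.1 p. 112; §12.5 p. 182.
* [Schikhof1984] W. H. Schikhof, *Ultrametric Calculus*, Cambridge (1984), §27.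
-/

set_option autoImplicit false
-- the mandated namespace has the single-problem summit's repeated segment (`HodgeConjecture.HodgeConjecture`)
set_option linter.dupNamespace false

noncomputable section

open MeasureTheory MeasureTheory.Measure Filter Metric Set Polynomial
open scoped Matrix Matrix.Norms.Elementwise Topology ENNReal Pointwise NNReal
open Literature.Analysis.Calculus Literature.Analysis.Matrix Literature.LinearAlgebra.Matrix Literature.NumberTheory.Automorphic
open Summit.HodgeConjecture.HodgeConjecture.Cruxes.H413.F0P3cStCharTSHCDescentSemisimpleAlg
open Summit.HodgeConjecture.HodgeConjecture.Cruxes.H413.F0P3cStCharTSHCDescentSemisimpleSliceK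
open Summit.HodgeConjecture.HodgeConjecture.Cruxes.H413.F0P3cStCharTSHCDescentSemisimpleSlice

namespace Summit.HodgeConjecture.HodgeConjecture.Cruxes.H413.F0P3cStCharTSHCDescentSemisimple

section Descent

variable {K : Type*} [NontriviallyNormedField K] [IsUltrametricDist K] [CompleteSpace K] {n : Type*} [Fintype n] [DecidableEq n]
  (σ : K →+* K) (J : Matrix n n K)

set_option maxHeartbeats 800000 in
-- long subtype-product carriers; instance unification across the `Matrix`/`Pi`/`Submodule` topologies is the cost
/-- **HARISH-CHANDRA DESCENT TO THE CENTRALISER, `L¹_loc` FORM.**  In the setting of file C₂ (`exists_slice_chart`), let `μ𝔲`, `μ𝔠` be additive Haar measures on `𝔲` and on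
`𝔠 = 𝔲 ⊓ ker (ad S₀)` (any Borel structure on `↥𝔲`; the one on `↥𝔠` induced from `M_n(K)`), and let `g : M_n(K) → ℝ≥0∞` be measurable with `charpoly X = charpoly Y → g X = g Y`.  If `∫⁻ Z in closedBall 0 ρ, g (S₀ + Z) ∂μ𝔠 < ∞` for some
`ρ > 0`, then `g` is integrable on a neighbourhood of `S₀` in `𝔲`: `∃ U ∈ 𝓝 S₀, ∫⁻ X in U, g X ∂μ𝔲 < ∞`.
[cite: HarishChandra1970, Part VI Lemma 22; Part VII §1 Thm. 15] [cite: Rogawski1990, §8.2 Prop. 8.2.1 p. 112] -/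
theorem exists_nhds_setLIntegral_lt_top_of_slice [PerfectField K] [CharZero K] [ProperSpace K] [SecondCountableTopology K]
    [MeasurableSpace (Matrix n n K)] [BorelSpace (Matrix n n K)]
    {F : Type*} [Field F] [Algebra F K] (hJ : IsUnit J.det)
    (hσ : Continuous σ) (𝔲 : Submodule F (Matrix n n K)) (h𝔲 : ∀ X : Matrix n n K, X ∈ 𝔲 ↔ (X.map σ)ᵀ * J + J * X = 0)
    {S₀ : Matrix n n K} (hS : (S₀.map σ)ᵀ * J + J * S₀ = 0) {p : K[X]} (hp : p.Separable) (hpS : aeval S₀ p = 0)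
    [MeasurableSpace ↥𝔲] [BorelSpace ↥𝔲] (μ𝔲 : Measure ↥𝔲) [μ𝔲.IsAddHaarMeasure]
    (μ𝔠 : Measure ↥(𝔲 ⊓ (LinearMap.ker (LinearMap.mulLeft K S₀ - LinearMap.mulRight K S₀ : Module.End K (Matrix n n K))).restrictScalars F)) [μ𝔠.IsAddHaarMeasure]
    (g : Matrix n n K → ℝ≥0∞) (hgm : Measurable g) (hg : ∀ X Y : Matrix n n K, X.charpoly = Y.charpoly → g X = g Y)
    (h𝔠 : ∃ ρ : ℝ, 0 < ρ ∧ ∫⁻ Z in closedBall (0 : ↥(𝔲 ⊓ (LinearMap.ker (LinearMap.mulLeft K S₀ - LinearMap.mulRight K S₀ : Module.End K (Matrix n n K))).restrictScalars F)) ρ,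
      g (S₀ + (Z : Matrix n n K)) ∂μ𝔠 < ∞) :
    ∃ U ∈ 𝓝 (⟨S₀, (h𝔲 S₀).2 hS⟩ : ↥𝔲), ∫⁻ X in U, g (X : Matrix n n K) ∂μ𝔲 < ∞ := by
  -- instances on the carriers (as in file C₂)
  haveI : IsUltrametricDist (Matrix n n K) := isUltrametricDist_matrix
  haveI : SecondCountableTopology (Matrix n n K) := inferInstanceAs (SecondCountableTopology (n → n → K))
  haveI hU𝔪 := isUltrametricDist_submodule (𝔲 ⊓ (LinearMap.range (LinearMap.mulLeft K S₀ - LinearMap.mulRight K S₀ : Module.End K (Matrix n n K))).restrictScalars F)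
  haveI hU𝔠 := isUltrametricDist_submodule (𝔲 ⊓ (LinearMap.ker (LinearMap.mulLeft K S₀ - LinearMap.mulRight K S₀ : Module.End K (Matrix n n K))).restrictScalars F)
  haveI : IsUltrametricDist (↥(𝔲 ⊓ (LinearMap.range (LinearMap.mulLeft K S₀ - LinearMap.mulRight K S₀ : Module.End K (Matrix n n K))).restrictScalars F) ×
      ↥(𝔲 ⊓ (LinearMap.ker (LinearMap.mulLeft K S₀ - LinearMap.mulRight K S₀ : Module.End K (Matrix n n K))).restrictScalars F)) := isUltrametricDist_prod
  have h𝔲cl : IsClosed (𝔲 : Set (Matrix n n K)) := by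
    have : (𝔲 : Set (Matrix n n K)) = {X : Matrix n n K | (X.map σ)ᵀ * J + J * X = 0} := Set.ext fun X => by simpa using h𝔲 X
    rw [this]; exact isClosed_skew σ J hσ
  have h𝔪cl : IsClosed ((𝔲 ⊓ (LinearMap.range (LinearMap.mulLeft K S₀ - LinearMap.mulRight K S₀ : Module.End K (Matrix n n K))).restrictScalars F :
      Submodule F (Matrix n n K)) : Set (Matrix n n K)) := by
    rw [Submodule.coe_inf]
    exact h𝔲cl.inter (Submodule.closed_of_finiteDimensional _)
  have h𝔠cl : IsClosed ((𝔲 ⊓ (LinearMap.ker (LinearMap.mulLeft K S₀ - LinearMap.mulRight K S₀ : Module.End K (Matrix n n K))).restrictScalars F :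
      Submodule F (Matrix n n K)) : Set (Matrix n n K)) := by
    rw [Submodule.coe_inf]
    exact h𝔲cl.inter (Submodule.closed_of_finiteDimensional _)
  haveI : ProperSpace ↥(𝔲 ⊓ (LinearMap.range (LinearMap.mulLeft K S₀ - LinearMap.mulRight K S₀ : Module.End K (Matrix n n K))).restrictScalars F) :=
    properSpace_subtype_of_isClosed h𝔪cl
  haveI : ProperSpace ↥(𝔲 ⊓ (LinearMap.ker (LinearMap.mulLeft K S₀ - LinearMap.mulRight K S₀ : Module.End K (Matrix n n K))).restrictScalars F) :=
    properSpace_subtype_of_isClosed h𝔠cl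
  haveI : ProperSpace ↥𝔲 := properSpace_subtype_of_isClosed h𝔲cl
  haveI : LocallyCompactSpace (Matrix n n K) := inferInstanceAs (LocallyCompactSpace (n → n → K))
  haveI : LocallyCompactSpace ↥(𝔲 ⊓ (LinearMap.range (LinearMap.mulLeft K S₀ - LinearMap.mulRight K S₀ : Module.End K (Matrix n n K))).restrictScalars F) :=
    h𝔪cl.locallyCompactSpace
  haveI : LocallyCompactSpace ↥(𝔲 ⊓ (LinearMap.ker (LinearMap.mulLeft K S₀ - LinearMap.mulRight K S₀ : Module.End K (Matrix n n K))).restrictScalars F) :=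
    h𝔠cl.locallyCompactSpace
  haveI : LocallyCompactSpace ↥𝔲 := h𝔲cl.locallyCompactSpace
  haveI : SecondCountableTopology ↥(𝔲 ⊓ (LinearMap.range (LinearMap.mulLeft K S₀ - LinearMap.mulRight K S₀ : Module.End K (Matrix n n K))).restrictScalars F) :=
    TopologicalSpace.Subtype.secondCountableTopology _
  haveI : SecondCountableTopology ↥(𝔲 ⊓ (LinearMap.ker (LinearMap.mulLeft K S₀ - LinearMap.mulRight K S₀ : Module.End K (Matrix n n K))).restrictScalars F) :=
    TopologicalSpace.Subtype.secondCountableTopology _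
  haveI : SecondCountableTopology ↥𝔲 := TopologicalSpace.Subtype.secondCountableTopology _
  haveI hB : BorelSpace (↥(𝔲 ⊓ (LinearMap.range (LinearMap.mulLeft K S₀ - LinearMap.mulRight K S₀ : Module.End K (Matrix n n K))).restrictScalars F) ×
      ↥(𝔲 ⊓ (LinearMap.ker (LinearMap.mulLeft K S₀ - LinearMap.mulRight K S₀ : Module.End K (Matrix n n K))).restrictScalars F)) := Prod.borelSpace
  -- Haar on `𝔪` and the product measure on `𝔪 × 𝔠`
  set μ𝔪 : Measure ↥(𝔲 ⊓ (LinearMap.range (LinearMap.mulLeft K S₀ - LinearMap.mulRight K S₀ : Module.End K (Matrix n n K))).restrictScalars F) :=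
    Measure.addHaar with hμ𝔪
  haveI hμ𝔪H : μ𝔪.IsAddHaarMeasure := by rw [hμ𝔪]; infer_instance
  set μ : Measure (↥(𝔲 ⊓ (LinearMap.range (LinearMap.mulLeft K S₀ - LinearMap.mulRight K S₀ : Module.End K (Matrix n n K))).restrictScalars F) ×
      ↥(𝔲 ⊓ (LinearMap.ker (LinearMap.mulLeft K S₀ - LinearMap.mulRight K S₀ : Module.End K (Matrix n n K))).restrictScalars F)) := μ𝔪.prod μ𝔠 with hμ
  haveI hμH : μ.IsAddHaarMeasure := by rw [hμ]; infer_instance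
  -- box filtration `Λ_j = closedBall 0 (½·½ʲ)` and the slice chart of file C₂
  obtain ⟨Λ, hΛ⟩ := exists_addSubgroup_coe_eq_closedBall
    (↥(𝔲 ⊓ (LinearMap.range (LinearMap.mulLeft K S₀ - LinearMap.mulRight K S₀ : Module.End K (Matrix n n K))).restrictScalars F) ×
      ↥(𝔲 ⊓ (LinearMap.ker (LinearMap.mulLeft K S₀ - LinearMap.mulRight K S₀ : Module.End K (Matrix n n K))).restrictScalars F))
    (r := (1 / 2 : ℝ)) (γ := (1 / 2 : ℝ)) (by norm_num) (by norm_num)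
  obtain ⟨e, k₀, he, hchart⟩ := exists_slice_chart σ J hJ hσ 𝔲 h𝔲 hS hp hpS μ hΛ (by norm_num) (by norm_num) (by norm_num)
  obtain ⟨ρ, hρ, hfin⟩ := h𝔠
  obtain ⟨k₁, hk₁⟩ := exists_pow_lt_of_lt_one hρ (by norm_num : (1 / 2 : ℝ) < 1)
  obtain ⟨hinj, himg, hlin⟩ := hchart (max k₀ k₁) (le_max_left _ _)
  have hρk : (1 / 2 : ℝ) * (1 / 2) ^ max k₀ k₁ ≤ ρ := by
    have h1 : ((1 : ℝ) / 2) ^ max k₀ k₁ ≤ (1 / 2) ^ k₁ := pow_le_pow_of_le_one (by norm_num) (by norm_num) (le_max_right _ _)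
    have h2 : (1 / 2 : ℝ) * (1 / 2) ^ max k₀ k₁ ≤ (1 / 2) ^ max k₀ k₁ := by
      have h0 : (0 : ℝ) ≤ (1 / 2) ^ max k₀ k₁ := by positivity
      nlinarith
    linarith
  have hρk1 : (1 / 2 : ℝ) * (1 / 2) ^ max k₀ k₁ < 1 := by
    have h1 : ((1 : ℝ) / 2) ^ max k₀ k₁ ≤ 1 := pow_le_one₀ (by norm_num) (by norm_num)
    linarith
  -- the neighbourhood `U = S₀ + e(Λ_k)`
  set S₀' : ↥𝔲 := ⟨S₀, (h𝔲 S₀).2 hS⟩ with hS₀'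
  have hΛn : (Λ (max k₀ k₁) : Set _) ∈ 𝓝 (0 : ↥(𝔲 ⊓ (LinearMap.range (LinearMap.mulLeft K S₀ - LinearMap.mulRight K S₀ : Module.End K (Matrix n n K))).restrictScalars F) ×
      ↥(𝔲 ⊓ (LinearMap.ker (LinearMap.mulLeft K S₀ - LinearMap.mulRight K S₀ : Module.End K (Matrix n n K))).restrictScalars F)) := by
    rw [hΛ]; exact closedBall_mem_nhds _ (by positivity)
  have hTn : (e : _ → ↥𝔲) '' (Λ (max k₀ k₁) : Set _) ∈ 𝓝 (0 : ↥𝔲) := by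
    have h := e.toHomeomorph.isOpenMap.image_mem_nhds hΛn
    rw [show e.toHomeomorph (0 : _) = (0 : ↥𝔲) from map_zero e] at h
    exact h
  have hTcl : IsClosed ((e : _ → ↥𝔲) '' (Λ (max k₀ k₁) : Set _)) := by
    have hc : IsClosed (Λ (max k₀ k₁) : Set (↥(𝔲 ⊓ (LinearMap.range (LinearMap.mulLeft K S₀ - LinearMap.mulRight K S₀ : Module.End K (Matrix n n K))).restrictScalars F) ×
      ↥(𝔲 ⊓ (LinearMap.ker (LinearMap.mulLeft K S₀ - LinearMap.mulRight K S₀ : Module.End K (Matrix n n K))).restrictScalars F))) := by rw [hΛ]; exact isClosed_closedBall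
    exact (e.toHomeomorph.isClosed_image).2 hc
  have hTm : MeasurableSet ((e : _ → ↥𝔲) '' (Λ (max k₀ k₁) : Set _)) := hTcl.measurableSet
  refine ⟨(fun Y : ↥𝔲 => S₀' + Y) '' ((e : _ → ↥𝔲) '' (Λ (max k₀ k₁) : Set _)), ?_, ?_⟩
  · have h := (Homeomorph.addLeft S₀').isOpenMap.image_mem_nhds hTn
    simpa only [Homeomorph.coe_addLeft, add_zero] using h
  -- the integral: `μ𝔲 = c • μ.map e`, left invariance, change of variables along `e`, file C₂, conjugation invariance, Tonelli
  haveI : (μ.map (e : _ → ↥𝔲)).IsAddHaarMeasure := e.isAddHaarMeasure_map μ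
  have hsmul := isAddLeftInvariant_eq_smul μ𝔲 (μ.map (e : _ → ↥𝔲))
  have hGm : Measurable fun Y : ↥𝔲 => g ((S₀' + Y : ↥𝔲) : Matrix n n K) :=
    hgm.comp ((continuous_subtype_val.comp (continuous_const.add continuous_id)).measurable)
  haveI hBo : OpensMeasurableSpace (↥(𝔲 ⊓ (LinearMap.range (LinearMap.mulLeft K S₀ - LinearMap.mulRight K S₀ : Module.End K (Matrix n n K))).restrictScalars F) ×
      ↥(𝔲 ⊓ (LinearMap.ker (LinearMap.mulLeft K S₀ - LinearMap.mulRight K S₀ : Module.End K (Matrix n n K))).restrictScalars F)) := hB.opensMeasurable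
  have hem : Measurable (e : _ → ↥𝔲) := @Continuous.measurable _ _ _ _ hBo _ _ _ _ e.continuous
  -- names for the two sets and the two integrands
  set T : Set ↥𝔲 := (e : _ → ↥𝔲) '' (Λ (max k₀ k₁) : Set _) with hT
  set U : Set ↥𝔲 := (fun Y : ↥𝔲 => S₀' + Y) '' T with hU
  set G : ↥𝔲 → ℝ≥0∞ := fun X => g (X : Matrix n n K) with hG
  set GS : ↥𝔲 → ℝ≥0∞ := fun Y => g ((S₀' + Y : ↥𝔲) : Matrix n n K) with hGS
  -- (a) left invariance of the Haar measure `μ.map e`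
  have hstep1 : ∫⁻ X in U, G X ∂(μ.map (e : _ → ↥𝔲)) = ∫⁻ Y in T, GS Y ∂(μ.map (e : _ → ↥𝔲)) := by
    have hUm : MeasurableSet U := ((Homeomorph.addLeft S₀').isClosed_image.2 hTcl).measurableSet
    rw [← lintegral_indicator hUm, ← lintegral_indicator hTm, ← lintegral_add_left_eq_self (μ := μ.map (e : _ → ↥𝔲)) (U.indicator G) S₀']
    congr 1
    funext Y
    rw [hU, Set.indicator_image (add_right_injective S₀')]
    rfl
  -- (b) change of variables along `e`
  have hstep2 : ∫⁻ Y in T, GS Y ∂(μ.map (e : _ → ↥𝔲)) = ∫⁻ q in (Λ (max k₀ k₁) : Set _), g (S₀ + ((e q : ↥𝔲) : Matrix n n K)) ∂μ := by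
    rw [setLIntegral_map hTm hGm hem, hT, e.injective.preimage_image]
    rfl
  -- (c) file C₂ and conjugation invariance on the box
  have hstep3 : ∫⁻ q in (Λ (max k₀ k₁) : Set _), g (S₀ + ((e q : ↥𝔲) : Matrix n n K)) ∂μ =
      ∫⁻ q in (Λ (max k₀ k₁) : Set _), g (S₀ + ((q.2 : ↥(𝔲 ⊓ (LinearMap.ker (LinearMap.mulLeft K S₀ - LinearMap.mulRight K S₀ : Module.End K (Matrix n n K))).restrictScalars F)) : Matrix n n K)) ∂μ := by
    rw [← hlin g hgm]
    have hΛm : MeasurableSet (Λ (max k₀ k₁) : Set (↥(𝔲 ⊓ (LinearMap.range (LinearMap.mulLeft K S₀ - LinearMap.mulRight K S₀ : Module.End K (Matrix n n K))).restrictScalars F) ×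
        ↥(𝔲 ⊓ (LinearMap.ker (LinearMap.mulLeft K S₀ - LinearMap.mulRight K S₀ : Module.End K (Matrix n n K))).restrictScalars F))) :=
      @IsClosed.measurableSet _ _ _ _ hBo (by rw [hΛ]; exact isClosed_closedBall)
    refine setLIntegral_congr_fun hΛm (fun q hq => ?_)
    apply hg
    have hq1 : ‖((q.1 : ↥(𝔲 ⊓ (LinearMap.range (LinearMap.mulLeft K S₀ - LinearMap.mulRight K S₀ : Module.End K (Matrix n n K))).restrictScalars F)) : Matrix n n K)‖ < 1 := by
      have hq' : ‖q‖ ≤ (1 / 2 : ℝ) * (1 / 2) ^ max k₀ k₁ := by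
        have : q ∈ closedBall (0 : _) ((1 / 2 : ℝ) * (1 / 2) ^ max k₀ k₁) := by rw [← hΛ]; exact hq
        rwa [mem_closedBall_zero_iff] at this
      calc ‖((q.1 : ↥(𝔲 ⊓ (LinearMap.range (LinearMap.mulLeft K S₀ - LinearMap.mulRight K S₀ : Module.End K (Matrix n n K))).restrictScalars F)) : Matrix n n K)‖
            = ‖q.1‖ := (Submodule.coe_norm _).symm
        _ ≤ ‖q‖ := norm_fst_le q
        _ < 1 := hq'.trans_lt hρk1
    exact charpoly_slice_eq hq1
  -- (d) Tonelli on the product box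
  have hstep4 : ∫⁻ q in (Λ (max k₀ k₁) : Set _), g (S₀ + ((q.2 : ↥(𝔲 ⊓ (LinearMap.ker (LinearMap.mulLeft K S₀ - LinearMap.mulRight K S₀ : Module.End K (Matrix n n K))).restrictScalars F)) : Matrix n n K)) ∂μ =
      μ𝔪 (closedBall 0 ((1 / 2 : ℝ) * (1 / 2) ^ max k₀ k₁)) *
        ∫⁻ Z in closedBall (0 : ↥(𝔲 ⊓ (LinearMap.ker (LinearMap.mulLeft K S₀ - LinearMap.mulRight K S₀ : Module.End K (Matrix n n K))).restrictScalars F)) ((1 / 2 : ℝ) * (1 / 2) ^ max k₀ k₁),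
          g (S₀ + (Z : Matrix n n K)) ∂μ𝔠 := by
    have hF : Measurable fun Z : ↥(𝔲 ⊓ (LinearMap.ker (LinearMap.mulLeft K S₀ - LinearMap.mulRight K S₀ : Module.End K (Matrix n n K))).restrictScalars F) =>
        g (S₀ + (Z : Matrix n n K)) := hgm.comp ((continuous_const.add continuous_subtype_val).measurable)
    rw [hΛ, show (0 : ↥(𝔲 ⊓ (LinearMap.range (LinearMap.mulLeft K S₀ - LinearMap.mulRight K S₀ : Module.End K (Matrix n n K))).restrictScalars F) ×
        ↥(𝔲 ⊓ (LinearMap.ker (LinearMap.mulLeft K S₀ - LinearMap.mulRight K S₀ : Module.End K (Matrix n n K))).restrictScalars F)) = ((0 : _), (0 : _)) from rfl,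
      ← closedBall_prod_same, hμ, ← Measure.prod_restrict]
    have h1 := lintegral_prod_mul (μ := μ𝔪.restrict (closedBall 0 ((1 / 2 : ℝ) * (1 / 2) ^ max k₀ k₁)))
      (ν := μ𝔠.restrict (closedBall 0 ((1 / 2 : ℝ) * (1 / 2) ^ max k₀ k₁))) (f := fun _ => (1 : ℝ≥0∞))
      (g := fun Z => g (S₀ + (Z : Matrix n n K))) aemeasurable_const hF.aemeasurable
    simp only [one_mul, lintegral_const, Measure.restrict_apply_univ] at h1
    exact h1
  -- finiteness
  have hfin' : ∫⁻ Z in closedBall (0 : ↥(𝔲 ⊓ (LinearMap.ker (LinearMap.mulLeft K S₀ - LinearMap.mulRight K S₀ : Module.End K (Matrix n n K))).restrictScalars F)) ((1 / 2 : ℝ) * (1 / 2) ^ max k₀ k₁),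
      g (S₀ + (Z : Matrix n n K)) ∂μ𝔠 < ∞ :=
    lt_of_le_of_lt (lintegral_mono_set (closedBall_subset_closedBall hρk)) hfin
  have hμ𝔪fin : μ𝔪 (closedBall 0 ((1 / 2 : ℝ) * (1 / 2) ^ max k₀ k₁)) < ∞ :=
    @IsCompact.measure_lt_top _ _ _ μ𝔪 hμ𝔪H.toIsFiniteMeasureOnCompacts _ (isCompact_closedBall _ _)
  rw [hsmul, Measure.restrict_smul, lintegral_smul_measure, hstep1, hstep2, hstep3, hstep4, ENNReal.smul_def, smul_eq_mul]
  exact ENNReal.mul_lt_top ENNReal.coe_lt_top (ENNReal.mul_lt_top hμ𝔪fin hfin')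

end Descent

end Summit.HodgeConjecture.HodgeConjecture.Cruxes.H413.F0P3cStCharTSHCDescentSemisimple

end
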